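import Summits.QuantumFields.YangMills.Theorems.BalabanUVNodesN18RunDifferenceOfLocalTerms
import Summits.QuantumFields.YangMills.Theorems.BalabanUVNodesN22WindowSoftTwoPointDomSys

/-!
# BalabanUVNodes ∕ N18 — THE TERMWISE RUN-DIFFERENCE ROAD, PART 2: the (5.10) leaves DISCHARGED on def-T's catalogue of record (dag-n22-w2's `…DomSys` Σ-junction, one run up)
# and the RECORD editions (merged term family of record, Stage 13, under W1-20's law `Localizes17OfRecord₁₃`) — node N18's letter OF RECORD `KernelStepRateOfRecord₁₃` from
# per-matched-pair two-run bounds of the (2.13) terms on `T^{(k+2)}_{K+1}`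
# (Track A, DAG node N18 = NE5; key K3⁸ `SpineGivenEndpointR13SepCoPHV` = stmt-QuantumFields-27366 (K3⁷ 20544 aside since route rev 28∕29); cell `pub-ymgap`,
# WIDTH SEAT `pub-ymgap-dag-n18-w2` g9, FILE 2 = PART 2; `--kind proof --supports stmt-QuantumFields-27366 --as helper`, COUNT-NEUTRAL; THEOREMS ONLY, 0 `def`, 0 `sorry`)

WHY.  PART 1 (`…N18RunDifferenceOfLocalTerms`) turned W1-19b's two-run letter at `s = 1` for W1-20's (1.7) localized sum `localizedSum F S emb` into ONE term-level input:
per run pair `(K, K+1)`, level `k`, box history `w` and MATCHED pair of localization domains `(X, castDom (domSys_succ F M K (k+1)) X)` (def-W1's `𝐃_{k+2}(T_{K+1}) =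
𝐃_{k+1}(T_K)`), a SOFT two-run bound for the difference of the two (2.13) terms' colour-diagonal (1.20) kernels at the window sites of `T^{(k+2)}_{K+1}`, resummed by
dag-n22-w2's (5.10) leaves and passed to the limit by dag-n18-w1's `kernelStepRate_of_windowed'`.  K3's bill (dag-n27-w1 `K3V5Defs.keyedRatesHolderD4_rrOfRecord_of_pins_of_letters`,
row `h18`; the v6 mirror awaited after rev 28∕29) reads node N18 through the letter OF RECORD `KernelStepRateOfRecord₁₃ F N θ κ θ₅ C₅` (def-W1 `Node00/U3KernelLetters` §2) at
the pinned kernels `objectsOfRecord₁₃`; def-W1's READING-SIDE dictionary (`windowedStepRateOfRecord₁₃_iff_of_localizes ∕ polLimitsExistOfRecord₁₃_iff_of_localizes ∕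
kernelStepRateOfRecord₁₃_iff_of_localizes`) makes the letters of record those of the localized sum under the law `Localizes17OfRecord₁₃ F N θ S emb`.  dag-n22-w2's third storey
`…N22WindowSoftTwoPointDomSys.eventually_le_of_softSum_domSys` discharges the three leaves ON THE CATALOGUE OF RECORD for print's cube sides `M = L^{m′}` (any real sequence `Δ K`
bounded by Σ-shaped per-`K` bounds with K-uniform soft majorants in the CAST geometry ⇒ `∀ᶠ K, Δ K ≤ C·w·e^{−δ₁|z|₁}`, no geometry parameter).  THIS FILE composes: §4 runs that
Σ-junction ONE RUN UP (the run difference lives on `T^{(k+2)}_{K+1}`; the sequence is shifted by `tendsto_add_atTop_nat 1`), §5–§6 are the record editions.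

WHAT.  §4 (reading level, leaves DISCHARGED, `M = L^{m′}`): ★★ `eventually_abs_runDifference_le_of_softSum` (Σ-shaped per-`K` bounds for the windowed run difference — PART 1's
`…_le_soft_of_holomorphic` is the producer — with soft majorants `C_E·θ^{k+1}·e^{−κ d(X)}·e^{−δ₀ distCT(cast site z, X)}·e^{−δ₀ distCT(cast site 0, X)}` on run B's catalogue
`𝐃_{k+2}(T_{K+1})` ⇒ `∀ᶠ K, … ≤ C_E e^{12Mδ₁}K₀(64,8)K₁(4,δ₀∕2)·θ^{k+1}·e^{−δ₁|z|₁}`, `δ₁ = ½min{δ₀, κ(4M)⁻¹}`) · ★★★ `windowedStepRate_localizedSum_one_of_softSum` ·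
★★ `kernelStepRate_localizedSum_of_softSum`.  §5 (record chart `θ.ρ8 ∕ θ.bV`, colour index `θ.ιβ`, window radius `θ.γ`; the `letI` instances of `U3KernelLetters` §2; ANY site
geometry with the three leaves, PART 1 §3 composed with the dictionary): ★★ `windowedStepRateOfRecord₁₃_one_of_termwise` (⇒ `WindowedStepRateOfRecord₁₃ F N θ 1 δ₁ θ₅ (C₅′·θ₅)`, `C₅′ := C_E e^{δ₁M₉c₁}K₀K₁`) ·
★★★ `kernelStepRateOfRecord₁₃_of_termwise` (+ `PolLimitsExistOfRecord₁₃ F N θ` ⇒ `KernelStepRateOfRecord₁₃ F N θ δ₁ θ₅ C₅′` — THE LETTER THE K3 PIN READS FOR NODE N18) ·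
`n18At_u3OfRecord₁₃_objectsOfRecord₁₃_of_termwise` (the N18 slot `N18At (u3OfRecord₁₃ θ (objectsOfRecord₁₃ F N θ ℓ) j)` at a letter block `ℓ` whose N18 letters are displayed
as the equations `ℓ.κ = δ₁`, `ℓ.θ₅ = θ₅`, `ℓ.C₅ = C₅′`).  §6 (record, leaves DISCHARGED): ★★★ `kernelStepRateOfRecord₁₃_of_softSum` (W1-20's law + (1.21)-existence
of record + Σ-shaped run-difference bounds with K-uniform soft majorants of weight `C_E·θ₅^{k+1}` ⇒ `KernelStepRateOfRecord₁₃ F N θ δ₁ θ₅ (C_E e^{12Mδ₁}K₀(64,8)K₁(4,δ₀∕2))`) ·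
`n18At_u3OfRecord₁₃_objectsOfRecord₁₃_of_softSum`.
What a producer of node N18's letter of record therefore owes, EXACTLY: W1-20's law (NODE A ∕ N10 content), (1.21)-existence of record, `C²` of the (2.13) terms' charts in the
record's β-chart ([I] p. 264) — or, in §6, just the Σ-shape of PART 1's soft theorem — and ONE TERM-LEVEL TWO-RUN BOUND per matched pair — `C_E·θ₅^{k+1}·e^{−κ d(X)}·e^{−δ₀dist(z·,X)}·e^{−δ₀dist(0·,X)}` for the difference of the two runs'
terms read on one torus through the two minimizers (PART 1's `…_le_soft_of_holomorphic` derives it from analyticity + a sup bound `‖G_B X − G_A X‖ ≤ M X` on the ball).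

HONEST FRAMING — what this is NOT.  Count-neutral composition of PART 1 with dag-n22-w2's Σ-junction (one index shift) and def-W1's reading-side dictionary; NO estimate of Bałaban's is proved or asserted — the
term-level two-run bound (NE5 for the (2.13) terms: [I] Thm 1's uniformity in the spacing AS A RATE, King's (3.73) mechanism; NOT PRINTED for d = 4 Yang–Mills), the
analyticity of the terms, the leaves' constants, (1.21)-existence and the law (1.7) are DISPLAYED hypotheses; nothing of the merged term (1.6) constructed; no letter OF RECORD
inhabited; N18 ∕ N22 ∕ (D4) NOT discharged; K3⁸ OPEN (skeleton v6 awaited), not claimed; counts UNMOVED (typed 28∕28 · discharged 5∕27 (A 5∕28)); one finite four-torus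
programme at fixed ε, Bałaban AS PRINTED; R4 closes the conditional finite-𝕋⁴ rung `BalabanLadder.UV` only — NOT ℝ⁴, NOT infinite volume, NOT OS, NOT a mass gap; the Clay
problem is NOT proved by any of this.

References (TYPES only): [I] = [Balaban1987RG1] (0.24)–(0.25) p. 257, Thm 1 p. 259, (1.7) p. 261, (1.20)–(1.22) p. 264, (5.10) p. 293; [II] = [Balaban1988RG2Cluster] (2.13)–(2.14)
pp. 14–15; C. King, CMP 102 (1986) [King1986] (3.73) p. 665.  Imports PART 1 (through it g8's `…N18TwoRunWindowLevelShiftRecord`, dag-n18-w1's `…N18AtRecordOfKernelLetters`,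
def-W1's `U3KernelLetters ∕ LocalizedSum17 ∕ RateRecordW1Maps`) and dag-n22-w2's `…N22WindowSoftTwoPointDomSys` (`eventually_le_of_softSum_domSys`, the cast geometry of
`B12Decay510Torus` and the constants `delta1 ∕ K₀ ∕ K₁ ∕ kappa₀`) BY NAME; nothing re-declared.
-/

noncomputable section

namespace YMDAG.N18.RunDifferenceOfLocalTerms

open Filter
open scoped BigOperators Topology
open Literature.MathematicalPhysics.QuantumFieldTheory.Balaban1983to89
open Literature.MathematicalPhysics.QuantumFieldTheory.Balaban1983to89.T4Continuum (T4Family)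
open Literature.MathematicalPhysics.QuantumFieldTheory.Balaban1983to89.FlowStep (Box)
open Literature.MathematicalPhysics.QuantumFieldTheory.Balaban1983to89.B12PolarizationTensor120 (polComp expChart)
open Literature.MathematicalPhysics.QuantumFieldTheory.Balaban1983to89.B12Sec2to5 (l1)
open Literature.MathematicalPhysics.QuantumFieldTheory.Balaban1983to89.Node00 (Stage13Params U3Letters₁₁ polWindow siteOfInt MatA)
open Literature.MathematicalPhysics.QuantumFieldTheory.Balaban1983to89.Node00.U3OfKernels (objectsOfRecord₁₃)
open Literature.MathematicalPhysics.QuantumFieldTheory.Balaban1983to89.Node00.U3KernelLetters (WindowedStepRate KernelStepRate PolLimitsExist WindowedStepRateOfRecord₁₃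
  PolLimitsExistOfRecord₁₃ KernelStepRateOfRecord₁₃ windowedStepRateOfRecord₁₃_iff_of_localizes polLimitsExistOfRecord₁₃_iff_of_localizes kernelStepRateOfRecord₁₃_iff_of_localizes)
open Literature.MathematicalPhysics.QuantumFieldTheory.Balaban1983to89.Node00.LocalizedSum17 (localizedSum ReadingMaps Localizes17OfRecord₁₃)
open Literature.MathematicalPhysics.QuantumFieldTheory.Balaban1983to89.Node00.Sect2 (domSys domCount)
open Literature.MathematicalPhysics.QuantumFieldTheory.Balaban1983to89.Node00.W1 (ClusterTower castDom domSys_succ)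
open Literature.MathematicalPhysics.QuantumFieldTheory.Balaban1983to89.T4LevelShift (siteShift)
open Literature.MathematicalPhysics.QuantumFieldTheory.Balaban1983to89.T4OutputRate (Window)
open Literature.MathematicalPhysics.QuantumFieldTheory.Balaban1983to89.B12Decay510 (SiteGeometry GeomLeaf CubeSumLeaf TreeLeaf delta1)
open Literature.MathematicalPhysics.QuantumFieldTheory.Balaban1983to89.B12Decay510Window (K₁)
open Literature.MathematicalPhysics.QuantumFieldTheory.Balaban1983to89.B12Decay510Torus (pl1 distCT nearT)
open Literature.MathematicalPhysics.QuantumFieldTheory.Balaban1983to89.B12TreeDecay (K₀ kappa₀)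
open Literature.MathematicalPhysics.QuantumFieldTheory.Balaban1983to89.TreeLengthTorus (TPt torusTreeLen)
open YMDAG.UVSplit (N18At u3OfRecord₁₃)
open YMDAG.N22.WindowSoftTwoPoint (eventually_le_of_softSum_domSys)
open YMDAG.N18.TwoRunWindowLevelShift (ladder windowedStepRate_one_iff_sameTorus)
open YMDAG.N18.AtRecordOfKernelLetters (kernelStepRate_of_windowed' n18At_u3OfRecord₁₃_objectsOfRecord₁₃_of_kernelStepRateOfRecord₁₃)

/-! ## §4 The (5.10) leaves DISCHARGED on the catalogue of record: dag-n22-w2's Σ-junction one run up, and the letters from Σ-shaped run-difference bounds -/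

section SoftSum

variable {𝔄 : Type*} [NormedRing 𝔄] [NormedAlgebra ℝ 𝔄] {V : Type*} [NormedAddCommGroup V] [NormedSpace ℝ V] {ι : Type*} [Fintype ι] {𝔸 : Type*}
variable (F : T4Family) (m' : ℕ) (M : ℕ) [NeZero M] (hM : M = F.L ^ m')
variable (S : (K : ℕ) → ClusterTower (F.P K) 𝔸 M) (emb : ReadingMaps F 𝔄 𝔸) (ρ : V →L[ℝ] 𝔄) (bV : Module.Basis ι ℝ V)

include hM in
/-- ★★ **Σ-SHAPED RUN-DIFFERENCE BOUNDS + K-UNIFORM SOFT MAJORANTS ⇒ THE WINDOWED RUN-DIFFERENCE BOUND, EVENTUALLY IN `K`, NO GEOMETRY PARAMETER** (one level `k`, one box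
history `w`, one kernel entry; print's cube sides `M = L^{m′}`).  IF for every run pair `(K, K+1)` the windowed run difference of the localized sum on `T^{(k+2)}_{K+1}` is bounded by a
SUM over run B's catalogue `𝐃_{k+2}(T_{K+1})`, `≤ Σ_X a K X` (PART 1's `abs_polWindow_runDifference_localizedSum_le_soft_of_holomorphic`: `a K X = 16·M(X)∕r²·w_X(z·)·w_X(0·)`), and
the summands obey the soft majorants `a K X ≤ C_E·θ^{k+1}·e^{−κ d(X)}·e^{−δ₀ distCT(cast site z, X)}·e^{−δ₀ distCT(cast site 0, X)}` in the cast geometry of record with `(C_E, κ, δ₀)`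
free of `K` (`δ₀ > 0`, `κ∕2 ≥ κ₀(64,8)`), THEN for all large `K` the run difference is `≤ C_E e^{12Mδ₁}K₀(64,8)K₁(4,δ₀∕2)·θ^{k+1}·e^{−δ₁|z|₁}`, `δ₁ = ½min{δ₀, κ(4M)⁻¹}` —
dag-n22-w2's `eventually_le_of_softSum_domSys` at the sequence shifted by one run. [cite: Balaban1987RG1, Thm 1 p.259, (1.20)-(1.21) p.264 and (5.10) p.293; King1986, (3.73) p.665] -/
theorem eventually_abs_runDifference_le_of_softSum (k : ℕ) (w : Fin (k + 2) → ℝ) (μ ν : Fin 4) (z : Fin 4 → ℤ)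
    (a : (K : ℕ) → (domSys (F.P (K + 1)) M (k + 1 + 1)).Dom → ℝ) {CE θ κ δ₀ : ℝ} (hCE : 0 ≤ CE) (hθ : 0 ≤ θ) (hδ₀ : 0 < δ₀)
    (hκ : kappa₀ (4 * 2 ^ 4) (2 * 4) ≤ κ / 2)
    (hΔ : ∀ K, |polWindow F (K + 1) (k + 1 + 1) (localizedSum F S emb (k + 1) w (K + 1)) ρ bV μ ν z -
        polWindow F (K + 1) (k + 1 + 1)
          (fun W' : Fin (F.P (K + 1)).d → Site (F.P (K + 1)) (k + 1 + 1) → 𝔄 => localizedSum F S emb k (Fin.tail w) K (fun κ' y => W' κ' (siteShift (ladder F K k) y)))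
          ρ bV μ ν z| ≤ ∑ X, a K X)
    (ha : ∀ (K : ℕ) (X : (domSys (F.P (K + 1)) M (k + 1 + 1)).Dom),
      let e : Site (F.P (K + 1)) (k + 1 + 1) → TPt 4 (domCount (F.P (K + 1)) M (k + 1 + 1) * M) :=
        fun x i => (ZMod.cast (x i) : ZMod (domCount (F.P (K + 1)) M (k + 1 + 1) * M))
      a K X ≤ CE * θ ^ (k + 1) * Real.exp (-κ * torusTreeLen X.1) *
          Real.exp (-δ₀ * distCT (domCount (F.P (K + 1)) M (k + 1 + 1)) M (e (siteOfInt F (K + 1) (k + 1 + 1) z)) (nearT (M := M) (e (siteOfInt F (K + 1) (k + 1 + 1) z)) X)) *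
          Real.exp (-δ₀ * distCT (domCount (F.P (K + 1)) M (k + 1 + 1)) M (e (siteOfInt F (K + 1) (k + 1 + 1) 0)) (nearT (M := M) (e (siteOfInt F (K + 1) (k + 1 + 1) 0)) X))) :
    ∀ᶠ K in atTop,
      |polWindow F (K + 1) (k + 1 + 1) (localizedSum F S emb (k + 1) w (K + 1)) ρ bV μ ν z -
          polWindow F (K + 1) (k + 1 + 1)
            (fun W' : Fin (F.P (K + 1)).d → Site (F.P (K + 1)) (k + 1 + 1) → 𝔄 => localizedSum F S emb k (Fin.tail w) K (fun κ' y => W' κ' (siteShift (ladder F K k) y)))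
            ρ bV μ ν z| ≤
        CE * Real.exp (delta1 δ₀ κ ((M : ℝ) * 4) * ((M : ℝ) * 4) * 3) * K₀ (4 * 2 ^ 4) (2 * 4) * K₁ 4 (δ₀ / 2) * θ ^ (k + 1) *
          Real.exp (-(delta1 δ₀ κ ((M : ℝ) * 4) * l1 z)) := by
  -- the run-pair sequence read as a torus-indexed sequence (index `K' = K + 1`; the value at `K' = 0` is irrelevant and set to `0`)
  let Δ' : ℕ → ℝ := fun K' => match K' with
    | 0 => 0
    | K + 1 => |polWindow F (K + 1) (k + 1 + 1) (localizedSum F S emb (k + 1) w (K + 1)) ρ bV μ ν z -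
        polWindow F (K + 1) (k + 1 + 1)
          (fun W' : Fin (F.P (K + 1)).d → Site (F.P (K + 1)) (k + 1 + 1) → 𝔄 => localizedSum F S emb k (Fin.tail w) K (fun κ' y => W' κ' (siteShift (ladder F K k) y)))
          ρ bV μ ν z|
  let a' : (K' : ℕ) → (domSys (F.P K') M (k + 1 + 1)).Dom → ℝ := fun K' => match K' with
    | 0 => fun _ => 0
    | K + 1 => a K
  have hΔ' : ∀ K', Δ' K' ≤ ∑ X, a' K' X := by
    intro K'
    cases K' with
    | zero => simp [Δ', a']
    | succ K => exact hΔ K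
  have ha' : ∀ (K' : ℕ) (X : (domSys (F.P K') M (k + 1 + 1)).Dom),
      let e : Site (F.P K') (k + 1 + 1) → TPt 4 (domCount (F.P K') M (k + 1 + 1) * M) := fun x i => (ZMod.cast (x i) : ZMod (domCount (F.P K') M (k + 1 + 1) * M))
      a' K' X ≤ CE * θ ^ (k + 1) * Real.exp (-κ * torusTreeLen X.1) *
          Real.exp (-δ₀ * distCT (domCount (F.P K') M (k + 1 + 1)) M (e (siteOfInt F K' (k + 1 + 1) z)) (nearT (M := M) (e (siteOfInt F K' (k + 1 + 1) z)) X)) *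
          Real.exp (-δ₀ * distCT (domCount (F.P K') M (k + 1 + 1)) M (e (siteOfInt F K' (k + 1 + 1) 0)) (nearT (M := M) (e (siteOfInt F K' (k + 1 + 1) 0)) X)) := by
    intro K' X
    cases K' with
    | zero => exact mul_nonneg (mul_nonneg (mul_nonneg (mul_nonneg hCE (pow_nonneg hθ _)) (Real.exp_pos _).le) (Real.exp_pos _).le) (Real.exp_pos _).le
    | succ K => exact ha K X
  have h := eventually_le_of_softSum_domSys F (k + 1 + 1) m' M hM Δ' a' hCE (pow_nonneg hθ (k + 1)) hδ₀ hκ z hΔ' ha'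
  exact (tendsto_add_atTop_nat 1).eventually h

include hM in
/-- ★★★ **W1-19b's TWO-RUN LETTER FOR THE LOCALIZED SUM FROM Σ-SHAPED TERMWISE TWO-RUN BOUNDS, LEAVES DISCHARGED** (`s = 1`, `M = L^{m′}`).  IF for every level `k`, box history
`w ∈ ]0,γ]^{k+2}`, kernel entry `(μ, ν)`, separation `z` and run pair `(K, K+1)` the windowed run difference on `T^{(k+2)}_{K+1}` is bounded by `Σ_X a k w μ ν z K X` over run B's
catalogue, with soft majorants of weight `C_E·θ^{k+1}` and constants `(C_E, κ, δ₀)` free of all of them — the TERM-LEVEL two-run content, DISPLAYED —, THEN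
`WindowedStepRate F (localizedSum F S emb) ρ bV γ 1 δ₁ θ (C₅′·θ)`, `δ₁ = ½min{δ₀, κ(4M)⁻¹}`, `C₅′ = C_E e^{12Mδ₁}K₀(64,8)K₁(4,δ₀∕2)` (g8's `windowedStepRate_one_iff_sameTorus`; no `C²` of the
sum needed). [cite: Balaban1987RG1, Thm 1 p.259, (1.7) p.261, (1.20)-(1.21) p.264 and (5.10) p.293; King1986, (3.73) p.665] -/
theorem windowedStepRate_localizedSum_one_of_softSum {γ CE θ κ δ₀ : ℝ} (hCE : 0 ≤ CE) (hθ : 0 ≤ θ) (hδ₀ : 0 < δ₀) (hκ : kappa₀ (4 * 2 ^ 4) (2 * 4) ≤ κ / 2)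
    (a : (k : ℕ) → (Fin (k + 2) → ℝ) → Fin 4 → Fin 4 → (Fin 4 → ℤ) → (K : ℕ) → (domSys (F.P (K + 1)) M (k + 1 + 1)).Dom → ℝ)
    (hΔ : ∀ (k : ℕ) (w : Fin (k + 2) → ℝ), w ∈ Box γ (k + 1) → ∀ (μ ν : Fin 4) (z : Fin 4 → ℤ) (K : ℕ),
      |polWindow F (K + 1) (k + 1 + 1) (localizedSum F S emb (k + 1) w (K + 1)) ρ bV μ ν z -
          polWindow F (K + 1) (k + 1 + 1)
            (fun W' : Fin (F.P (K + 1)).d → Site (F.P (K + 1)) (k + 1 + 1) → 𝔄 => localizedSum F S emb k (Fin.tail w) K (fun κ' y => W' κ' (siteShift (ladder F K k) y)))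
            ρ bV μ ν z| ≤ ∑ X, a k w μ ν z K X)
    (ha : ∀ (k : ℕ) (w : Fin (k + 2) → ℝ), w ∈ Box γ (k + 1) → ∀ (μ ν : Fin 4) (z : Fin 4 → ℤ) (K : ℕ) (X : (domSys (F.P (K + 1)) M (k + 1 + 1)).Dom),
      let e : Site (F.P (K + 1)) (k + 1 + 1) → TPt 4 (domCount (F.P (K + 1)) M (k + 1 + 1) * M) :=
        fun x i => (ZMod.cast (x i) : ZMod (domCount (F.P (K + 1)) M (k + 1 + 1) * M))
      a k w μ ν z K X ≤ CE * θ ^ (k + 1) * Real.exp (-κ * torusTreeLen X.1) *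
          Real.exp (-δ₀ * distCT (domCount (F.P (K + 1)) M (k + 1 + 1)) M (e (siteOfInt F (K + 1) (k + 1 + 1) z)) (nearT (M := M) (e (siteOfInt F (K + 1) (k + 1 + 1) z)) X)) *
          Real.exp (-δ₀ * distCT (domCount (F.P (K + 1)) M (k + 1 + 1)) M (e (siteOfInt F (K + 1) (k + 1 + 1) 0)) (nearT (M := M) (e (siteOfInt F (K + 1) (k + 1 + 1) 0)) X))) :
    WindowedStepRate F (localizedSum F S emb) ρ bV γ 1 (delta1 δ₀ κ ((M : ℝ) * 4)) θ
      (CE * Real.exp (delta1 δ₀ κ ((M : ℝ) * 4) * ((M : ℝ) * 4) * 3) * K₀ (4 * 2 ^ 4) (2 * 4) * K₁ 4 (δ₀ / 2) * θ) := by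
  refine (windowedStepRate_one_iff_sameTorus F (localizedSum F S emb) ρ bV γ _ θ _).2 fun k w hw μ ν x => ?_
  have h := eventually_abs_runDifference_le_of_softSum F m' M hM S emb ρ bV k w μ ν x (a k w μ ν x) hCE hθ hδ₀ hκ (hΔ k w hw μ ν x) (ha k w hw μ ν x)
  filter_upwards [h] with K hK
  calc _ ≤ _ := hK
    _ = CE * Real.exp (delta1 δ₀ κ ((M : ℝ) * 4) * ((M : ℝ) * 4) * 3) * K₀ (4 * 2 ^ 4) (2 * 4) * K₁ 4 (δ₀ / 2) * θ * θ ^ k *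
          Real.exp (-delta1 δ₀ κ ((M : ℝ) * 4) * l1 x) := by rw [pow_succ, neg_mul]; ring

include hM in
/-- ★★ **NODE N18's LETTER `KernelStepRate` FOR THE LOCALIZED SUM, LEAVES DISCHARGED** (+ W1-19b's `PolLimitsExist … (Window γ)`; dag-n18-w1's `kernelStepRate_of_windowed'` at `s = 1`):
`KernelStepRate F (localizedSum F S emb) ρ bV γ δ₁ θ (C_E e^{12Mδ₁}K₀(64,8)K₁(4,δ₀∕2))`. [cite: Balaban1987RG1, Thm 1 p.259, (1.7) p.261 and (1.21) p.264] -/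
theorem kernelStepRate_localizedSum_of_softSum {γ CE θ κ δ₀ : ℝ} (hex : PolLimitsExist F (localizedSum F S emb) ρ bV (Window γ))
    (hCE : 0 ≤ CE) (hθ : 0 ≤ θ) (hδ₀ : 0 < δ₀) (hκ : kappa₀ (4 * 2 ^ 4) (2 * 4) ≤ κ / 2)
    (a : (k : ℕ) → (Fin (k + 2) → ℝ) → Fin 4 → Fin 4 → (Fin 4 → ℤ) → (K : ℕ) → (domSys (F.P (K + 1)) M (k + 1 + 1)).Dom → ℝ)
    (hΔ : ∀ (k : ℕ) (w : Fin (k + 2) → ℝ), w ∈ Box γ (k + 1) → ∀ (μ ν : Fin 4) (z : Fin 4 → ℤ) (K : ℕ),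
      |polWindow F (K + 1) (k + 1 + 1) (localizedSum F S emb (k + 1) w (K + 1)) ρ bV μ ν z -
          polWindow F (K + 1) (k + 1 + 1)
            (fun W' : Fin (F.P (K + 1)).d → Site (F.P (K + 1)) (k + 1 + 1) → 𝔄 => localizedSum F S emb k (Fin.tail w) K (fun κ' y => W' κ' (siteShift (ladder F K k) y)))
            ρ bV μ ν z| ≤ ∑ X, a k w μ ν z K X)
    (ha : ∀ (k : ℕ) (w : Fin (k + 2) → ℝ), w ∈ Box γ (k + 1) → ∀ (μ ν : Fin 4) (z : Fin 4 → ℤ) (K : ℕ) (X : (domSys (F.P (K + 1)) M (k + 1 + 1)).Dom),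
      let e : Site (F.P (K + 1)) (k + 1 + 1) → TPt 4 (domCount (F.P (K + 1)) M (k + 1 + 1) * M) :=
        fun x i => (ZMod.cast (x i) : ZMod (domCount (F.P (K + 1)) M (k + 1 + 1) * M))
      a k w μ ν z K X ≤ CE * θ ^ (k + 1) * Real.exp (-κ * torusTreeLen X.1) *
          Real.exp (-δ₀ * distCT (domCount (F.P (K + 1)) M (k + 1 + 1)) M (e (siteOfInt F (K + 1) (k + 1 + 1) z)) (nearT (M := M) (e (siteOfInt F (K + 1) (k + 1 + 1) z)) X)) *
          Real.exp (-δ₀ * distCT (domCount (F.P (K + 1)) M (k + 1 + 1)) M (e (siteOfInt F (K + 1) (k + 1 + 1) 0)) (nearT (M := M) (e (siteOfInt F (K + 1) (k + 1 + 1) 0)) X))) :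
    KernelStepRate F (localizedSum F S emb) ρ bV γ (delta1 δ₀ κ ((M : ℝ) * 4)) θ
      (CE * Real.exp (delta1 δ₀ κ ((M : ℝ) * 4) * ((M : ℝ) * 4) * 3) * K₀ (4 * 2 ^ 4) (2 * 4) * K₁ 4 (δ₀ / 2)) :=
  kernelStepRate_of_windowed' F ρ bV 1 hex (windowedStepRate_localizedSum_one_of_softSum F m' M hM S emb ρ bV hCE hθ hδ₀ hκ a hΔ ha)

end SoftSum

/-! ## §5 AT THE RECORD, Stage 13: under W1-20's law `Localizes17OfRecord₁₃`, node N18's letters OF RECORD from termwise two-run bounds (any site geometry with the leaves) -/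

section Record

open scoped Matrix.Norms.L2Operator

variable {𝔸 : Type*} {M : ℕ} (F : T4Family) (N : ℕ) [NeZero N]

/-- ★★ **NODE N18's FINITE-VOLUME LETTER OF RECORD FROM TERMWISE TWO-RUN BOUNDS** (`s = 1`).  Under W1-20's law `Localizes17OfRecord₁₃ F N θ S emb` (the merged term family of
record IS the reading's (1.7) localized sum): K-uniform leaves on site geometries of `T^{(k+2)}_{K+1}` over run B's catalogues, `C²` charts of the (2.13) terms in the record's β-chart
`θ.ρ8 ∕ θ.bV`, and per matched pair the soft two-run bound with weight `C_E·θ₅^{k+1}` on the boxes of `]0, θ.γ]` ⇒ `WindowedStepRateOfRecord₁₃ F N θ 1 δ₁ θ₅ (C₅′·θ₅)`,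
`C₅′ := C_E e^{δ₁M₉c₁}K₀K₁` (def-W1's `windowedStepRateOfRecord₁₃_iff_of_localizes` ∘ §3). [cite: Balaban1987RG1, Thm 1 p.259, (1.7) p.261, (1.20)-(1.21) p.264 and (5.10) p.293; Balaban1988RG2Cluster, (2.14) p.15] -/
theorem windowedStepRateOfRecord₁₃_one_of_termwise (θ : Stage13Params F N) (S : (K : ℕ) → ClusterTower (F.P K) 𝔸 M) (emb : ReadingMaps F (MatA N) 𝔸)
    (hloc : Localizes17OfRecord₁₃ F N θ S emb)
    (C : (k K : ℕ) → B12.CubeCover (domSys (F.P (K + 1)) M (k + 1 + 1))) (G : (k K : ℕ) → SiteGeometry (C k K) (Site (F.P (K + 1)) (k + 1 + 1)))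
    (hB : letI := θ.instVβ₁; letI := θ.instVβ₂
      ∀ (k : ℕ) (w : Fin (k + 2) → ℝ), w ∈ Box θ.γ (k + 1) → ∀ (K : ℕ) (X : (domSys (F.P (K + 1)) M (k + 1 + 1)).Dom),
        ContDiffAt ℝ 2 (expChart (fun W' => (((S (K + 1)) (k + 1)).E w (emb (K + 1) (k + 1) W') X).re) θ.ρ8) 0)
    (hA : letI := θ.instVβ₁; letI := θ.instVβ₂
      ∀ (k : ℕ) (w : Fin (k + 2) → ℝ), w ∈ Box θ.γ (k + 1) → ∀ (K : ℕ) (X' : (domSys (F.P K) M (k + 1)).Dom),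
        ContDiffAt ℝ 2 (expChart (fun W' : Fin (F.P (K + 1)).d → Site (F.P (K + 1)) (k + 1 + 1) → MatA N =>
          (((S K) k).E (Fin.tail w) (emb K k (fun κ y => W' κ (siteShift (ladder F K k) y))) X').re) θ.ρ8) 0)
    {CE θ₅ κ δ₀ δ₁ M₉ c₁ K0 K1 : ℝ} (hCE : 0 ≤ CE) (hθ₅ : 0 ≤ θ₅) (hK0 : 0 ≤ K0) (hδ₁ : 0 ≤ δ₁) (hδ₁δ₀ : δ₁ ≤ δ₀ / 2) (hδ₁κ : δ₁ * M₉ ≤ κ / 2)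
    (hgeo : ∀ k K, GeomLeaf (G k K) (fun x y => pl1 (x - y)) M₉ c₁) (hcube : ∀ k K, CubeSumLeaf (G k K) (δ₀ / 2) K1) (htree : ∀ k K, TreeLeaf (C k K) (κ / 2) K0)
    (hterm : letI := θ.instVβ₁; letI := θ.instVβ₂; letI := θ.instιβ
      ∀ (k : ℕ) (w : Fin (k + 2) → ℝ), w ∈ Box θ.γ (k + 1) → ∀ (K : ℕ) (X : (domSys (F.P (K + 1)) M (k + 1 + 1)).Dom) (μ ν : Fin 4) (z : Fin 4 → ℤ) (c : θ.ιβ),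
        |polComp ℝ (expChart (fun W' => (((S (K + 1)) (k + 1)).E w (emb (K + 1) (k + 1) W') X).re) θ.ρ8) θ.bV
              (Fin.cast (F.P_d (K + 1)).symm μ) (siteOfInt F (K + 1) (k + 1 + 1) z) c (Fin.cast (F.P_d (K + 1)).symm ν) (siteOfInt F (K + 1) (k + 1 + 1) 0) c -
            polComp ℝ (expChart (fun W' : Fin (F.P (K + 1)).d → Site (F.P (K + 1)) (k + 1 + 1) → MatA N =>
              (((S K) k).E (Fin.tail w) (emb K k (fun κ y => W' κ (siteShift (ladder F K k) y))) (castDom (domSys_succ F M K (k + 1)) X)).re) θ.ρ8) θ.bV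
              (Fin.cast (F.P_d (K + 1)).symm μ) (siteOfInt F (K + 1) (k + 1 + 1) z) c (Fin.cast (F.P_d (K + 1)).symm ν) (siteOfInt F (K + 1) (k + 1 + 1) 0) c| ≤
          CE * θ₅ ^ (k + 1) * Real.exp (-κ * (domSys (F.P (K + 1)) M (k + 1 + 1)).dj X) * Real.exp (-δ₀ * (G k K).distD (siteOfInt F (K + 1) (k + 1 + 1) z) X) *
            Real.exp (-δ₀ * (G k K).distD (siteOfInt F (K + 1) (k + 1 + 1) 0) X)) :
    WindowedStepRateOfRecord₁₃ F N θ 1 δ₁ θ₅ (CE * Real.exp (δ₁ * M₉ * c₁) * K0 * K1 * θ₅) := by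
  letI := θ.instVβ₁; letI := θ.instVβ₂; letI := θ.instιβ
  exact (windowedStepRateOfRecord₁₃_iff_of_localizes F N θ S emb hloc 1 δ₁ θ₅ _).2
    (windowedStepRate_localizedSum_one_of_termwise F S emb θ.ρ8 θ.bV C G hB hA hCE hθ₅ hK0 hδ₁ hδ₁δ₀ hδ₁κ hgeo hcube htree hterm)

/-- ★★★ **NODE N18's LETTER OF RECORD `KernelStepRateOfRecord₁₃` FROM TERMWISE TWO-RUN BOUNDS** — the letter the K3 pin reads for node N18 (`U3PinnedKernels`, dag-n27-w1's
`K3V5Defs.keyedRatesHolderD4_rrOfRecord_of_pins_of_letters` row `h18`).  Under W1-20's law, (1.21)-existence of record `PolLimitsExistOfRecord₁₃ F N θ` and the hypotheses of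
`windowedStepRateOfRecord₁₃_one_of_termwise`: `KernelStepRateOfRecord₁₃ F N θ δ₁ θ₅ (C_E e^{δ₁M₉c₁} K₀ K₁)` (dag-n18-w1's `kernelStepRateOfRecord₁₃` road at `s = 1` via def-W1's
`kernelStepRateOfRecord₁₃_iff_of_localizes`).  What a producer of node N18's letter of record therefore owes: W1-20's law (NODE A ∕ N10), (1.21)-existence of record, analyticity
of the (2.13) terms in def-B's chart, the (5.10) leaves on the torus of print (dag-n22-w2's `…Torus ∕ …DomSys` discharge them), and ONE TERM-LEVEL TWO-RUN BOUND per matched pair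
of domains — the node's content, NOT PRINTED for d = 4. [cite: Balaban1987RG1, Thm 1 p.259, (1.7) p.261, (1.21) p.264 and (5.10) p.293; King1986, (3.73) p.665] -/
theorem kernelStepRateOfRecord₁₃_of_termwise (θ : Stage13Params F N) (S : (K : ℕ) → ClusterTower (F.P K) 𝔸 M) (emb : ReadingMaps F (MatA N) 𝔸)
    (hloc : Localizes17OfRecord₁₃ F N θ S emb) (hex : PolLimitsExistOfRecord₁₃ F N θ)
    (C : (k K : ℕ) → B12.CubeCover (domSys (F.P (K + 1)) M (k + 1 + 1))) (G : (k K : ℕ) → SiteGeometry (C k K) (Site (F.P (K + 1)) (k + 1 + 1)))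
    (hB : letI := θ.instVβ₁; letI := θ.instVβ₂
      ∀ (k : ℕ) (w : Fin (k + 2) → ℝ), w ∈ Box θ.γ (k + 1) → ∀ (K : ℕ) (X : (domSys (F.P (K + 1)) M (k + 1 + 1)).Dom),
        ContDiffAt ℝ 2 (expChart (fun W' => (((S (K + 1)) (k + 1)).E w (emb (K + 1) (k + 1) W') X).re) θ.ρ8) 0)
    (hA : letI := θ.instVβ₁; letI := θ.instVβ₂
      ∀ (k : ℕ) (w : Fin (k + 2) → ℝ), w ∈ Box θ.γ (k + 1) → ∀ (K : ℕ) (X' : (domSys (F.P K) M (k + 1)).Dom),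
        ContDiffAt ℝ 2 (expChart (fun W' : Fin (F.P (K + 1)).d → Site (F.P (K + 1)) (k + 1 + 1) → MatA N =>
          (((S K) k).E (Fin.tail w) (emb K k (fun κ y => W' κ (siteShift (ladder F K k) y))) X').re) θ.ρ8) 0)
    {CE θ₅ κ δ₀ δ₁ M₉ c₁ K0 K1 : ℝ} (hCE : 0 ≤ CE) (hθ₅ : 0 ≤ θ₅) (hK0 : 0 ≤ K0) (hδ₁ : 0 ≤ δ₁) (hδ₁δ₀ : δ₁ ≤ δ₀ / 2) (hδ₁κ : δ₁ * M₉ ≤ κ / 2)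
    (hgeo : ∀ k K, GeomLeaf (G k K) (fun x y => pl1 (x - y)) M₉ c₁) (hcube : ∀ k K, CubeSumLeaf (G k K) (δ₀ / 2) K1) (htree : ∀ k K, TreeLeaf (C k K) (κ / 2) K0)
    (hterm : letI := θ.instVβ₁; letI := θ.instVβ₂; letI := θ.instιβ
      ∀ (k : ℕ) (w : Fin (k + 2) → ℝ), w ∈ Box θ.γ (k + 1) → ∀ (K : ℕ) (X : (domSys (F.P (K + 1)) M (k + 1 + 1)).Dom) (μ ν : Fin 4) (z : Fin 4 → ℤ) (c : θ.ιβ),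
        |polComp ℝ (expChart (fun W' => (((S (K + 1)) (k + 1)).E w (emb (K + 1) (k + 1) W') X).re) θ.ρ8) θ.bV
              (Fin.cast (F.P_d (K + 1)).symm μ) (siteOfInt F (K + 1) (k + 1 + 1) z) c (Fin.cast (F.P_d (K + 1)).symm ν) (siteOfInt F (K + 1) (k + 1 + 1) 0) c -
            polComp ℝ (expChart (fun W' : Fin (F.P (K + 1)).d → Site (F.P (K + 1)) (k + 1 + 1) → MatA N =>
              (((S K) k).E (Fin.tail w) (emb K k (fun κ y => W' κ (siteShift (ladder F K k) y))) (castDom (domSys_succ F M K (k + 1)) X)).re) θ.ρ8) θ.bV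
              (Fin.cast (F.P_d (K + 1)).symm μ) (siteOfInt F (K + 1) (k + 1 + 1) z) c (Fin.cast (F.P_d (K + 1)).symm ν) (siteOfInt F (K + 1) (k + 1 + 1) 0) c| ≤
          CE * θ₅ ^ (k + 1) * Real.exp (-κ * (domSys (F.P (K + 1)) M (k + 1 + 1)).dj X) * Real.exp (-δ₀ * (G k K).distD (siteOfInt F (K + 1) (k + 1 + 1) z) X) *
            Real.exp (-δ₀ * (G k K).distD (siteOfInt F (K + 1) (k + 1 + 1) 0) X)) :
    KernelStepRateOfRecord₁₃ F N θ δ₁ θ₅ (CE * Real.exp (δ₁ * M₉ * c₁) * K0 * K1) := by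
  letI := θ.instVβ₁; letI := θ.instVβ₂; letI := θ.instιβ
  exact (kernelStepRateOfRecord₁₃_iff_of_localizes F N θ S emb hloc δ₁ θ₅ _).2
    (kernelStepRate_localizedSum_of_termwise F S emb θ.ρ8 θ.bV ((polLimitsExistOfRecord₁₃_iff_of_localizes F N θ S emb hloc).1 hex)
      C G hB hA hCE hθ₅ hK0 hδ₁ hδ₁δ₀ hδ₁κ hgeo hcube htree hterm)

/-- **THE N18 SLOT AT THE PINNED KERNELS OF RECORD FROM TERMWISE TWO-RUN BOUNDS** (letter block `ℓ`, every run length `j`; the block's N18 letters displayed as the equations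
`ℓ.κ = δ₁`, `ℓ.θ₅ = θ₅`, `ℓ.C₅ = C_E e^{δ₁M₉c₁}K₀K₁`). [cite: Balaban1987RG1, Thm 1 p.259 and (1.20)–(1.22) p.264] -/
theorem n18At_u3OfRecord₁₃_objectsOfRecord₁₃_of_termwise (θ : Stage13Params F N) (ℓ : U3Letters₁₁) (S : (K : ℕ) → ClusterTower (F.P K) 𝔸 M)
    (emb : ReadingMaps F (MatA N) 𝔸) (hloc : Localizes17OfRecord₁₃ F N θ S emb) (hex : PolLimitsExistOfRecord₁₃ F N θ)
    (C : (k K : ℕ) → B12.CubeCover (domSys (F.P (K + 1)) M (k + 1 + 1))) (G : (k K : ℕ) → SiteGeometry (C k K) (Site (F.P (K + 1)) (k + 1 + 1)))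
    (hB : letI := θ.instVβ₁; letI := θ.instVβ₂
      ∀ (k : ℕ) (w : Fin (k + 2) → ℝ), w ∈ Box θ.γ (k + 1) → ∀ (K : ℕ) (X : (domSys (F.P (K + 1)) M (k + 1 + 1)).Dom),
        ContDiffAt ℝ 2 (expChart (fun W' => (((S (K + 1)) (k + 1)).E w (emb (K + 1) (k + 1) W') X).re) θ.ρ8) 0)
    (hA : letI := θ.instVβ₁; letI := θ.instVβ₂
      ∀ (k : ℕ) (w : Fin (k + 2) → ℝ), w ∈ Box θ.γ (k + 1) → ∀ (K : ℕ) (X' : (domSys (F.P K) M (k + 1)).Dom),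
        ContDiffAt ℝ 2 (expChart (fun W' : Fin (F.P (K + 1)).d → Site (F.P (K + 1)) (k + 1 + 1) → MatA N =>
          (((S K) k).E (Fin.tail w) (emb K k (fun κ y => W' κ (siteShift (ladder F K k) y))) X').re) θ.ρ8) 0)
    {CE κ δ₀ M₉ c₁ K0 K1 : ℝ} (hCE : 0 ≤ CE) (hθ₅ : 0 ≤ ℓ.θ₅) (hK0 : 0 ≤ K0) (hδ₁ : 0 ≤ ℓ.κ) (hδ₁δ₀ : ℓ.κ ≤ δ₀ / 2) (hδ₁κ : ℓ.κ * M₉ ≤ κ / 2)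
    (hC₅ : ℓ.C₅ = CE * Real.exp (ℓ.κ * M₉ * c₁) * K0 * K1)
    (hgeo : ∀ k K, GeomLeaf (G k K) (fun x y => pl1 (x - y)) M₉ c₁) (hcube : ∀ k K, CubeSumLeaf (G k K) (δ₀ / 2) K1) (htree : ∀ k K, TreeLeaf (C k K) (κ / 2) K0)
    (hterm : letI := θ.instVβ₁; letI := θ.instVβ₂; letI := θ.instιβ
      ∀ (k : ℕ) (w : Fin (k + 2) → ℝ), w ∈ Box θ.γ (k + 1) → ∀ (K : ℕ) (X : (domSys (F.P (K + 1)) M (k + 1 + 1)).Dom) (μ ν : Fin 4) (z : Fin 4 → ℤ) (c : θ.ιβ),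
        |polComp ℝ (expChart (fun W' => (((S (K + 1)) (k + 1)).E w (emb (K + 1) (k + 1) W') X).re) θ.ρ8) θ.bV
              (Fin.cast (F.P_d (K + 1)).symm μ) (siteOfInt F (K + 1) (k + 1 + 1) z) c (Fin.cast (F.P_d (K + 1)).symm ν) (siteOfInt F (K + 1) (k + 1 + 1) 0) c -
            polComp ℝ (expChart (fun W' : Fin (F.P (K + 1)).d → Site (F.P (K + 1)) (k + 1 + 1) → MatA N =>
              (((S K) k).E (Fin.tail w) (emb K k (fun κ y => W' κ (siteShift (ladder F K k) y))) (castDom (domSys_succ F M K (k + 1)) X)).re) θ.ρ8) θ.bV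
              (Fin.cast (F.P_d (K + 1)).symm μ) (siteOfInt F (K + 1) (k + 1 + 1) z) c (Fin.cast (F.P_d (K + 1)).symm ν) (siteOfInt F (K + 1) (k + 1 + 1) 0) c| ≤
          CE * ℓ.θ₅ ^ (k + 1) * Real.exp (-κ * (domSys (F.P (K + 1)) M (k + 1 + 1)).dj X) * Real.exp (-δ₀ * (G k K).distD (siteOfInt F (K + 1) (k + 1 + 1) z) X) *
            Real.exp (-δ₀ * (G k K).distD (siteOfInt F (K + 1) (k + 1 + 1) 0) X))
    (j : ℕ) : N18At (u3OfRecord₁₃ θ (objectsOfRecord₁₃ F N θ ℓ) j) := by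
  refine n18At_u3OfRecord₁₃_objectsOfRecord₁₃_of_kernelStepRateOfRecord₁₃ F N θ ℓ j ?_
  rw [hC₅]
  exact kernelStepRateOfRecord₁₃_of_termwise F N θ S emb hloc hex C G hB hA hCE hθ₅ hK0 hδ₁ hδ₁δ₀ hδ₁κ hgeo hcube htree hterm

end Record

/-! ## §6 AT THE RECORD with the leaves DISCHARGED: node N18's letter of record from Σ-shaped termwise two-run bounds -/

section RecordSoftSum

open scoped Matrix.Norms.L2Operator

variable {𝔸 : Type*} (F : T4Family) (N : ℕ) [NeZero N] (m' : ℕ) (M : ℕ) [NeZero M] (hM : M = F.L ^ m')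

include hM in
/-- ★★★ **NODE N18's LETTER OF RECORD FROM Σ-SHAPED TERMWISE TWO-RUN BOUNDS, LEAVES DISCHARGED** (`M = L^{m′}`).  Under W1-20's law `Localizes17OfRecord₁₃ F N θ S emb` and
(1.21)-existence of record `PolLimitsExistOfRecord₁₃ F N θ`: IF for every level `k`, box history `w ∈ ]0, θ.γ]^{k+2}`, entry, separation and run pair the windowed run difference of
the reading's localized sum in the record's β-chart is bounded by a SUM over run B's catalogue whose summands obey K-uniform soft majorants of weight `C_E·θ₅^{k+1}` in the cast
geometry of record (term-level NE5 × the (4.35) tails — the node's content, DISPLAYED), THEN `KernelStepRateOfRecord₁₃ F N θ δ₁ θ₅ (C_E e^{12Mδ₁}K₀(64,8)K₁(4,δ₀∕2))`,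
`δ₁ = ½min{δ₀, κ(4M)⁻¹}` — the letter the K3 pin reads for node N18, with NO geometry parameter left. [cite: Balaban1987RG1, Thm 1 p.259, (1.7) p.261, (1.21) p.264 and (5.10) p.293; King1986, (3.73) p.665] -/
theorem kernelStepRateOfRecord₁₃_of_softSum (θ : Stage13Params F N) (S : (K : ℕ) → ClusterTower (F.P K) 𝔸 M) (emb : ReadingMaps F (MatA N) 𝔸)
    (hloc : Localizes17OfRecord₁₃ F N θ S emb) (hex : PolLimitsExistOfRecord₁₃ F N θ)
    {CE θ₅ κ δ₀ : ℝ} (hCE : 0 ≤ CE) (hθ₅ : 0 ≤ θ₅) (hδ₀ : 0 < δ₀) (hκ : kappa₀ (4 * 2 ^ 4) (2 * 4) ≤ κ / 2)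
    (a : (k : ℕ) → (Fin (k + 2) → ℝ) → Fin 4 → Fin 4 → (Fin 4 → ℤ) → (K : ℕ) → (domSys (F.P (K + 1)) M (k + 1 + 1)).Dom → ℝ)
    (hΔ : letI := θ.instVβ₁; letI := θ.instVβ₂; letI := θ.instιβ
      ∀ (k : ℕ) (w : Fin (k + 2) → ℝ), w ∈ Box θ.γ (k + 1) → ∀ (μ ν : Fin 4) (z : Fin 4 → ℤ) (K : ℕ),
        |polWindow F (K + 1) (k + 1 + 1) (localizedSum F S emb (k + 1) w (K + 1)) θ.ρ8 θ.bV μ ν z -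
            polWindow F (K + 1) (k + 1 + 1)
              (fun W' : Fin (F.P (K + 1)).d → Site (F.P (K + 1)) (k + 1 + 1) → MatA N => localizedSum F S emb k (Fin.tail w) K (fun κ' y => W' κ' (siteShift (ladder F K k) y)))
              θ.ρ8 θ.bV μ ν z| ≤ ∑ X, a k w μ ν z K X)
    (ha : ∀ (k : ℕ) (w : Fin (k + 2) → ℝ), w ∈ Box θ.γ (k + 1) → ∀ (μ ν : Fin 4) (z : Fin 4 → ℤ) (K : ℕ) (X : (domSys (F.P (K + 1)) M (k + 1 + 1)).Dom),
      let e : Site (F.P (K + 1)) (k + 1 + 1) → TPt 4 (domCount (F.P (K + 1)) M (k + 1 + 1) * M) :=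
        fun x i => (ZMod.cast (x i) : ZMod (domCount (F.P (K + 1)) M (k + 1 + 1) * M))
      a k w μ ν z K X ≤ CE * θ₅ ^ (k + 1) * Real.exp (-κ * torusTreeLen X.1) *
          Real.exp (-δ₀ * distCT (domCount (F.P (K + 1)) M (k + 1 + 1)) M (e (siteOfInt F (K + 1) (k + 1 + 1) z)) (nearT (M := M) (e (siteOfInt F (K + 1) (k + 1 + 1) z)) X)) *
          Real.exp (-δ₀ * distCT (domCount (F.P (K + 1)) M (k + 1 + 1)) M (e (siteOfInt F (K + 1) (k + 1 + 1) 0)) (nearT (M := M) (e (siteOfInt F (K + 1) (k + 1 + 1) 0)) X))) :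
    KernelStepRateOfRecord₁₃ F N θ (delta1 δ₀ κ ((M : ℝ) * 4)) θ₅
      (CE * Real.exp (delta1 δ₀ κ ((M : ℝ) * 4) * ((M : ℝ) * 4) * 3) * K₀ (4 * 2 ^ 4) (2 * 4) * K₁ 4 (δ₀ / 2)) := by
  letI := θ.instVβ₁; letI := θ.instVβ₂; letI := θ.instιβ
  exact (kernelStepRateOfRecord₁₃_iff_of_localizes F N θ S emb hloc _ θ₅ _).2
    (kernelStepRate_localizedSum_of_softSum F m' M hM S emb θ.ρ8 θ.bV ((polLimitsExistOfRecord₁₃_iff_of_localizes F N θ S emb hloc).1 hex)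
      hCE hθ₅ hδ₀ hκ a hΔ ha)

include hM in
/-- **THE N18 SLOT AT THE PINNED KERNELS OF RECORD, LEAVES DISCHARGED** (letter block `ℓ`, every run length `j`; the block's N18 letters displayed as the equations
`ℓ.κ = δ₁`, `ℓ.C₅ = C_E e^{12Mδ₁}K₀(64,8)K₁(4,δ₀∕2)`, rate `ℓ.θ₅`). [cite: Balaban1987RG1, Thm 1 p.259 and (1.20)–(1.22) p.264] -/
theorem n18At_u3OfRecord₁₃_objectsOfRecord₁₃_of_softSum (θ : Stage13Params F N) (ℓ : U3Letters₁₁) (S : (K : ℕ) → ClusterTower (F.P K) 𝔸 M)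
    (emb : ReadingMaps F (MatA N) 𝔸) (hloc : Localizes17OfRecord₁₃ F N θ S emb) (hex : PolLimitsExistOfRecord₁₃ F N θ)
    {CE κ δ₀ : ℝ} (hCE : 0 ≤ CE) (hθ₅ : 0 ≤ ℓ.θ₅) (hδ₀ : 0 < δ₀) (hκ : kappa₀ (4 * 2 ^ 4) (2 * 4) ≤ κ / 2)
    (hκℓ : ℓ.κ = delta1 δ₀ κ ((M : ℝ) * 4)) (hC₅ : ℓ.C₅ = CE * Real.exp (delta1 δ₀ κ ((M : ℝ) * 4) * ((M : ℝ) * 4) * 3) * K₀ (4 * 2 ^ 4) (2 * 4) * K₁ 4 (δ₀ / 2))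
    (a : (k : ℕ) → (Fin (k + 2) → ℝ) → Fin 4 → Fin 4 → (Fin 4 → ℤ) → (K : ℕ) → (domSys (F.P (K + 1)) M (k + 1 + 1)).Dom → ℝ)
    (hΔ : letI := θ.instVβ₁; letI := θ.instVβ₂; letI := θ.instιβ
      ∀ (k : ℕ) (w : Fin (k + 2) → ℝ), w ∈ Box θ.γ (k + 1) → ∀ (μ ν : Fin 4) (z : Fin 4 → ℤ) (K : ℕ),
        |polWindow F (K + 1) (k + 1 + 1) (localizedSum F S emb (k + 1) w (K + 1)) θ.ρ8 θ.bV μ ν z -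
            polWindow F (K + 1) (k + 1 + 1)
              (fun W' : Fin (F.P (K + 1)).d → Site (F.P (K + 1)) (k + 1 + 1) → MatA N => localizedSum F S emb k (Fin.tail w) K (fun κ' y => W' κ' (siteShift (ladder F K k) y)))
              θ.ρ8 θ.bV μ ν z| ≤ ∑ X, a k w μ ν z K X)
    (ha : ∀ (k : ℕ) (w : Fin (k + 2) → ℝ), w ∈ Box θ.γ (k + 1) → ∀ (μ ν : Fin 4) (z : Fin 4 → ℤ) (K : ℕ) (X : (domSys (F.P (K + 1)) M (k + 1 + 1)).Dom),
      let e : Site (F.P (K + 1)) (k + 1 + 1) → TPt 4 (domCount (F.P (K + 1)) M (k + 1 + 1) * M) :=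
        fun x i => (ZMod.cast (x i) : ZMod (domCount (F.P (K + 1)) M (k + 1 + 1) * M))
      a k w μ ν z K X ≤ CE * ℓ.θ₅ ^ (k + 1) * Real.exp (-κ * torusTreeLen X.1) *
          Real.exp (-δ₀ * distCT (domCount (F.P (K + 1)) M (k + 1 + 1)) M (e (siteOfInt F (K + 1) (k + 1 + 1) z)) (nearT (M := M) (e (siteOfInt F (K + 1) (k + 1 + 1) z)) X)) *
          Real.exp (-δ₀ * distCT (domCount (F.P (K + 1)) M (k + 1 + 1)) M (e (siteOfInt F (K + 1) (k + 1 + 1) 0)) (nearT (M := M) (e (siteOfInt F (K + 1) (k + 1 + 1) 0)) X)))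
    (j : ℕ) : N18At (u3OfRecord₁₃ θ (objectsOfRecord₁₃ F N θ ℓ) j) := by
  refine n18At_u3OfRecord₁₃_objectsOfRecord₁₃_of_kernelStepRateOfRecord₁₃ F N θ ℓ j ?_
  rw [hκℓ, hC₅]
  exact kernelStepRateOfRecord₁₃_of_softSum F N m' M hM θ S emb hloc hex hCE hθ₅ hδ₀ hκ a hΔ ha

end RecordSoftSum

end YMDAG.N18.RunDifferenceOfLocalTerms

end
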